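import Summits.ValiantsHypothesis.ValiantsHypothesis.Theorems.SymPencilPerFourPeeledTwoPencilFramePerm

/-!
# Route `SymPencil` — inner rank of the `2 | 2` row split of `per_4`, PEELED case: the COMBINATORIAL
# CLASSIFIER of correction matrices for the (8,8,11) coverage programme (`--supports`
# stmt-ValiantsHypothesis-5674 `SdcSuperquadratic`; (8,8) column, cell (8,8,11); memo
# `NOTE-p8g15-5674-R2-two-pencil.md` §9.4 "coverage, class by class"; rung currency only)

The coverage theorem "a frameless `Ψ ∈ K^{4×4}` is a pure swap" is organised (memo §9.4) by the
shape of `Ψ`.  Call columns `(c, c′)` a SWAP PAIR when column `c` is supported on row `c′` only,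
column `c′` on row `c` only, and `Ψ_{c′c} = Ψ_{cc′}` (the predicate excluded, triple by triple, in
the Case-A class theorem `…TwoPencilCaseAParams.hframes_of_caseA_class`).  **Theorem** (`classify`):
every `Ψ` is (up to a simultaneous coordinate permutation `σ`) in one of four classes —

* CASE A: for some `σ` the columns `σ0, σ1, σ2` are non-zero and contain no swap pair (hypotheses
  of `hframes_of_caseA_class` verbatim);
* R1: two zero columns `σ2, σ3` (contains `Ψ = 0`, three zero columns, `B ⊕ 0`, the generalised and
  the pure swap pairs);
* R2: one zero column `σ3`, a swap pair `(σ0, σ1)`, and a non-zero fourth column `σ2`;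
* R3: no zero column, a DOUBLE SWAP: `Ψ^σ = λ(E₀₁+E₁₀) + μ(E₂₃+E₃₂)`, `λμ ≠ 0`, in the literal
  form of `…TwoPencilSigmaZeroFrames.frames_of_double_swap`.

The proof is finite combinatorics: two swap pairs sharing a column kill that column
(`col_eq_zero_of_two_partners`); with no zero column and a swap pair in every triple of columns the
pairs are complementary.  Also here: `exists_perm_of_distinct` (a permutation with four prescribed
distinct values) and the PACKED transport `frames_of_submatrix` (a two-pencil frame for
`Ψ.submatrix σ σ` yields one for `Ψ`; `…TwoPencilFramePerm.frame_of_perm` repacked), so that the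
per-class frame lemmas can be pulled back along `σ` in one line by the coverage assembly.

Honest framing: bookkeeping for the coverage assembly; no chart, no frame and no cell here;
`28 ≤ sdc(per_4) ≤ 29` of record, the crux `SdcSuperquadratic` and `VP ≠ VNP` untouched.  No
definitions, no named facts. [folklore]
-/

noncomputable section

-- single-conjunct layout: Sub = Summit, duplicated namespace component intended
set_option linter.dupNamespace false

namespace Summit.ValiantsHypothesis.ValiantsHypothesis.Theorems.SymPencilPerFourPeeledTwoPencilClassify

open Matrix Finset Module
open Summit.ValiantsHypothesis.ValiantsHypothesis.Theorems.SymPencilPerFourPeeledTwoPencilFramePerm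

universe u

variable {K : Type u} [Field K]

/-- A permutation of `Fin 4` with four prescribed pairwise distinct values. [folklore] -/
theorem exists_perm_of_distinct (c₀ c₁ c₂ c₃ : Fin 4) (h01 : c₀ ≠ c₁) (h02 : c₀ ≠ c₂)
    (h03 : c₀ ≠ c₃) (h12 : c₁ ≠ c₂) (h13 : c₁ ≠ c₃) (h23 : c₂ ≠ c₃) :
    ∃ σ : Equiv.Perm (Fin 4), σ 0 = c₀ ∧ σ 1 = c₁ ∧ σ 2 = c₂ ∧ σ 3 = c₃ := by
  have hinj : Function.Injective (![c₀, c₁, c₂, c₃] : Fin 4 → Fin 4) := by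
    intro p q h
    fin_cases p <;> fin_cases q <;>
      simp only [Fin.zero_eta, Fin.mk_one, Fin.isValue, Fin.reduceFinMk, Matrix.cons_val_zero,
        Matrix.cons_val_one, Matrix.cons_val] at h <;>
      first
        | rfl
        | exact absurd h ‹_›
        | exact absurd h.symm ‹_›
  exact ⟨Equiv.ofBijective _ (Finite.injective_iff_bijective.mp hinj), rfl, rfl, rfl, rfl⟩

/-- Two swap partners for one column force that column to vanish. [folklore] -/
theorem col_eq_zero_of_two_partners (Ψ : Matrix (Fin 4) (Fin 4) K) (c c' c'' : Fin 4)
    (hne : c' ≠ c'') (h' : ∀ i, i ≠ c' → Ψ i c = 0) (h'' : ∀ i, i ≠ c'' → Ψ i c = 0) :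
    ∀ i, Ψ i c = 0 := by
  intro i
  by_cases hi : i = c'
  · exact h'' i (hi ▸ hne)
  · exact h' i hi

/-- **Packed transport of two-pencil frames along a coordinate permutation**: a frame for
`Ψ.submatrix σ σ` yields a frame for `Ψ` (`frame_of_perm` with `a₀ := a₀' ∘ σ⁻¹`). [folklore] -/
theorem frames_of_submatrix (σ : Equiv.Perm (Fin 4)) (Ψ : Matrix (Fin 4) (Fin 4) K)
    (h : ∃ (a₀ a₁ y₀ y₁ : Fin 4 → K) (P₀₀ P₁₀ P₀₁ P₁₁ W₀ : Matrix (Fin 4) (Fin 4) K)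
      (v : Fin 4 → Fin 4 → K) (s : Fin 4 → K) (W : Matrix (Fin 4) (Fin 4) K),
      a₀ ⬝ᵥ Ψ.submatrix σ σ *ᵥ y₀ = 0 ∧ a₀ ⬝ᵥ Ψ.submatrix σ σ *ᵥ y₁ = 0 ∧
      a₁ ⬝ᵥ Ψ.submatrix σ σ *ᵥ y₀ = 0 ∧ a₁ ⬝ᵥ Ψ.submatrix σ σ *ᵥ y₁ = 0 ∧
      (∀ b l, P₀₀ b l = (Matrix.of ![a₀, Pi.single b 1, y₀, Pi.single l 1]).permanent) ∧
      (∀ b l, P₁₀ b l = (Matrix.of ![a₀, Pi.single b 1, y₁, Pi.single l 1]).permanent) ∧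
      (∀ b l, P₀₁ b l = (Matrix.of ![a₁, Pi.single b 1, y₀, Pi.single l 1]).permanent) ∧
      (∀ b l, P₁₁ b l = (Matrix.of ![a₁, Pi.single b 1, y₁, Pi.single l 1]).permanent) ∧
      W₀ * P₀₀ = 1 ∧ (∀ j, P₁₀ *ᵥ v j = s j • P₀₀ *ᵥ v j) ∧ (∀ i j, i ≠ j → s i ≠ s j) ∧
      W * Matrix.of v = 1 ∧ P₁₁ - P₁₀ * W₀ * P₀₁ ≠ 0) :
    ∃ (a₀ a₁ y₀ y₁ : Fin 4 → K) (P₀₀ P₁₀ P₀₁ P₁₁ W₀ : Matrix (Fin 4) (Fin 4) K)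
      (v : Fin 4 → Fin 4 → K) (s : Fin 4 → K) (W : Matrix (Fin 4) (Fin 4) K),
      a₀ ⬝ᵥ Ψ *ᵥ y₀ = 0 ∧ a₀ ⬝ᵥ Ψ *ᵥ y₁ = 0 ∧ a₁ ⬝ᵥ Ψ *ᵥ y₀ = 0 ∧ a₁ ⬝ᵥ Ψ *ᵥ y₁ = 0 ∧
      (∀ b l, P₀₀ b l = (Matrix.of ![a₀, Pi.single b 1, y₀, Pi.single l 1]).permanent) ∧
      (∀ b l, P₁₀ b l = (Matrix.of ![a₀, Pi.single b 1, y₁, Pi.single l 1]).permanent) ∧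
      (∀ b l, P₀₁ b l = (Matrix.of ![a₁, Pi.single b 1, y₀, Pi.single l 1]).permanent) ∧
      (∀ b l, P₁₁ b l = (Matrix.of ![a₁, Pi.single b 1, y₁, Pi.single l 1]).permanent) ∧
      W₀ * P₀₀ = 1 ∧ (∀ j, P₁₀ *ᵥ v j = s j • P₀₀ *ᵥ v j) ∧ (∀ i j, i ≠ j → s i ≠ s j) ∧
      W * Matrix.of v = 1 ∧ P₁₁ - P₁₀ * W₀ * P₀₁ ≠ 0 := by
  obtain ⟨a₀, a₁, y₀, y₁, P₀₀, P₁₀, P₀₁, P₁₁, W₀, v, s, W, h00, h01, h10, h11, hP₀₀, hP₁₀, hP₀₁, hP₁₁,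
    hW₀, hv, hs, hW, hQ⟩ := h
  have e0 : (a₀ ∘ σ.symm) ∘ σ = a₀ := by funext k; simp
  have e1 : (a₁ ∘ σ.symm) ∘ σ = a₁ := by funext k; simp
  obtain ⟨y₀', y₁', Q₀₀, Q₁₀, Q₀₁, Q₁₁, V₀, v', s', W', k00, k01, k10, k11, kP₀₀, kP₁₀, kP₀₁, kP₁₁,
    kW₀, kv, ks, kW, kQ⟩ :=
    frame_of_perm σ Ψ (a₀ ∘ σ.symm) (a₁ ∘ σ.symm) y₀ y₁ P₀₀ P₁₀ P₀₁ P₁₁ W₀ v s W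
      (by rw [e0]; exact h00) (by rw [e0]; exact h01) (by rw [e1]; exact h10) (by rw [e1]; exact h11)
      (by rw [e0]; exact hP₀₀) (by rw [e0]; exact hP₁₀) (by rw [e1]; exact hP₀₁)
      (by rw [e1]; exact hP₁₁) hW₀ hv hs hW hQ
  exact ⟨a₀ ∘ σ.symm, a₁ ∘ σ.symm, y₀', y₁', Q₀₀, Q₁₀, Q₀₁, Q₁₁, V₀, v', s', W', k00, k01, k10, k11,
    kP₀₀, kP₁₀, kP₀₁, kP₁₁, kW₀, kv, ks, kW, kQ⟩

/-- ★ **The classifier.**  See the module docstring. [folklore] -/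
theorem classify (Ψ : Matrix (Fin 4) (Fin 4) K) :
    (∃ σ : Equiv.Perm (Fin 4), (∀ j : Fin 4, j ≠ 3 → ∃ i, Ψ i (σ j) ≠ 0) ∧
      (∀ j j' : Fin 4, j ≠ 3 → j' ≠ 3 → j ≠ j' →
        ¬ ((∀ i, i ≠ σ j' → Ψ i (σ j) = 0) ∧ (∀ i, i ≠ σ j → Ψ i (σ j') = 0) ∧
            Ψ (σ j') (σ j) = Ψ (σ j) (σ j')))) ∨
    (∃ σ : Equiv.Perm (Fin 4), ∀ i, Ψ i (σ 2) = 0 ∧ Ψ i (σ 3) = 0) ∨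
    (∃ σ : Equiv.Perm (Fin 4), (∀ i, Ψ i (σ 3) = 0) ∧ (∃ i, Ψ i (σ 2) ≠ 0) ∧
      Ψ (σ 1) (σ 0) ≠ 0 ∧ (∀ i, i ≠ σ 1 → Ψ i (σ 0) = 0) ∧ (∀ i, i ≠ σ 0 → Ψ i (σ 1) = 0) ∧
      Ψ (σ 1) (σ 0) = Ψ (σ 0) (σ 1)) ∨
    (∃ (σ : Equiv.Perm (Fin 4)) (la mu : K), la ≠ 0 ∧ mu ≠ 0 ∧
      Ψ.submatrix σ σ = !![0, la, 0, 0; la, 0, 0, 0; 0, 0, 0, mu; 0, 0, mu, 0]) := by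
  classical
  by_cases hA : ∃ σ : Equiv.Perm (Fin 4), (∀ j : Fin 4, j ≠ 3 → ∃ i, Ψ i (σ j) ≠ 0) ∧
      (∀ j j' : Fin 4, j ≠ 3 → j' ≠ 3 → j ≠ j' →
        ¬ ((∀ i, i ≠ σ j' → Ψ i (σ j) = 0) ∧ (∀ i, i ≠ σ j → Ψ i (σ j') = 0) ∧
            Ψ (σ j') (σ j) = Ψ (σ j) (σ j')))
  · exact Or.inl hA
  right
  push Not at hA
  -- finite index bookkeeping
  have third : ∀ j j' : Fin 4, ∃ k : Fin 4, k ≠ 3 ∧ k ≠ j ∧ k ≠ j' := by decide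
  have fourth : ∀ a b c : Fin 4, ∃ d : Fin 4, d ≠ a ∧ d ≠ b ∧ d ≠ c := by decide
  have last : ∀ a b k y : Fin 4, a ≠ b → k ≠ a → k ≠ b → k ≠ 3 → a ≠ 3 → b ≠ 3 →
      y ≠ a → y ≠ b → y ≠ 3 → y = k := by decide
  by_cases hZ2 : ∃ c c' : Fin 4, c ≠ c' ∧ (∀ i, Ψ i c = 0) ∧ (∀ i, Ψ i c' = 0)
  · -- R1: two zero columns
    obtain ⟨c, c', hcc, hc, hc'⟩ := hZ2
    obtain ⟨d, hdc, hdc', -⟩ := fourth c c' c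
    obtain ⟨e, hec, hec', hed⟩ := fourth c c' d
    obtain ⟨σ, -, -, h2, h3⟩ := exists_perm_of_distinct d e c c' hed.symm hdc hdc' hec hec' hcc
    exact Or.inl ⟨σ, fun i => ⟨by rw [h2]; exact hc i, by rw [h3]; exact hc' i⟩⟩
  push Not at hZ2
  right
  by_cases hZ1 : ∃ p : Fin 4, ∀ i, Ψ i p = 0
  · -- R2: exactly one zero column
    obtain ⟨p, hp⟩ := hZ1
    have hnz : ∀ c, c ≠ p → ∃ i, Ψ i c ≠ 0 := fun c hcp => hZ2 p c hcp.symm hp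
    set σ₀ : Equiv.Perm (Fin 4) := Equiv.swap p 3 with hσ₀def
    have hσ₀3 : σ₀ 3 = p := Equiv.swap_apply_right p 3
    have hσ₀ne : ∀ j, j ≠ 3 → σ₀ j ≠ p := fun j hj h => hj (σ₀.injective (h.trans hσ₀3.symm))
    obtain ⟨j, j', hj, hj', hjj', S1, S2, S3⟩ := hA σ₀ fun j hj => hnz _ (hσ₀ne j hj)
    obtain ⟨k, hk3, hkj, hkj'⟩ := third j j'
    have djj' : σ₀ j ≠ σ₀ j' := fun h => hjj' (σ₀.injective h)
    have djk : σ₀ j ≠ σ₀ k := fun h => hkj (σ₀.injective h).symm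
    have dj'k : σ₀ j' ≠ σ₀ k := fun h => hkj' (σ₀.injective h).symm
    obtain ⟨σ, h0, h1, h2, h3⟩ := exists_perm_of_distinct (σ₀ j) (σ₀ j') (σ₀ k) p djj' djk
      (hσ₀ne j hj) dj'k (hσ₀ne j' hj') (hσ₀ne k hk3)
    have hval : Ψ (σ₀ j') (σ₀ j) ≠ 0 := by
      obtain ⟨i, hi⟩ := hnz _ (hσ₀ne j hj)
      intro h0'
      by_cases hij : i = σ₀ j'
      · exact hi (hij ▸ h0')
      · exact hi (S1 i hij)
    refine Or.inl ⟨σ, ?_, ?_, ?_, ?_, ?_, ?_⟩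
    · rw [h3]; exact hp
    · rw [h2]; exact hnz _ (hσ₀ne k hk3)
    · rw [h0, h1]; exact hval
    · rw [h0, h1]; exact S1
    · rw [h0, h1]; exact S2
    · rw [h0, h1]; exact S3
  · -- R3: no zero column
    push Not at hZ1
    right
    obtain ⟨a, b, ha3, hb3, hab, S1, S2, S3⟩ := hA 1 fun j _ => hZ1 j
    simp only [Equiv.Perm.coe_one, id_eq] at S1 S2 S3
    obtain ⟨k, hk3, hka, hkb⟩ := third a b
    set σ₁ : Equiv.Perm (Fin 4) := Equiv.swap a 3 with hσ₁def
    have hσ₁3 : σ₁ 3 = a := Equiv.swap_apply_right a 3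
    have hσ₁ne : ∀ j, j ≠ 3 → σ₁ j ≠ a := fun j hj h => hj (σ₁.injective (h.trans hσ₁3.symm))
    obtain ⟨m, m', hm, hm', hmm', T1, T2, T3⟩ := hA σ₁ fun j _ => hZ1 _
    have hxa : σ₁ m ≠ a := hσ₁ne m hm
    have hx'a : σ₁ m' ≠ a := hσ₁ne m' hm'
    have hxx' : σ₁ m ≠ σ₁ m' := fun h => hmm' (σ₁.injective h)
    -- neither partner is `b`
    have hxb : σ₁ m ≠ b := by
      intro hx
      rw [hx] at T1
      obtain ⟨i, hi⟩ := hZ1 b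
      exact hi (col_eq_zero_of_two_partners Ψ b a (σ₁ m') hx'a.symm S2 T1 i)
    have hx'b : σ₁ m' ≠ b := by
      intro hx
      rw [hx] at T2
      obtain ⟨i, hi⟩ := hZ1 b
      exact hi (col_eq_zero_of_two_partners Ψ b a (σ₁ m) hxa.symm S2 T2 i)
    -- so the second pair is `{k, 3}`; orient it as `(k, 3)`
    have hpair : (∀ i, i ≠ 3 → Ψ i k = 0) ∧ (∀ i, i ≠ k → Ψ i 3 = 0) ∧ Ψ 3 k = Ψ k 3 := by
      by_cases hx3 : σ₁ m = 3
      · have hx'k : σ₁ m' = k :=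
          last a b k (σ₁ m') hab hka hkb hk3 ha3 hb3 hx'a hx'b (fun h => hxx' (hx3.trans h.symm))
        rw [hx3, hx'k] at T1 T2 T3
        exact ⟨T2, T1, T3.symm⟩
      · have hxk : σ₁ m = k := last a b k (σ₁ m) hab hka hkb hk3 ha3 hb3 hxa hxb hx3
        have hx'3 : σ₁ m' = 3 := by
          by_contra h
          exact hxx' (hxk.trans (last a b k (σ₁ m') hab hka hkb hk3 ha3 hb3 hx'a hx'b h).symm)
        rw [hxk, hx'3] at T1 T2 T3
        exact ⟨T1, T2, T3⟩
    obtain ⟨U1, U2, U3⟩ := hpair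
    obtain ⟨σ, h0, h1, h2, h3⟩ := exists_perm_of_distinct a b k 3 hab hka.symm ha3 hkb.symm hb3 hk3
    have hla : Ψ b a ≠ 0 := by
      obtain ⟨i, hi⟩ := hZ1 a
      intro h0'
      by_cases hib : i = b
      · exact hi (hib ▸ h0')
      · exact hi (S1 i hib)
    have hmu : Ψ 3 k ≠ 0 := by
      obtain ⟨i, hi⟩ := hZ1 k
      intro h0'
      by_cases hi3 : i = 3
      · exact hi (hi3 ▸ h0')
      · exact hi (U1 i hi3)
    refine ⟨σ, Ψ b a, Ψ 3 k, hla, hmu, ?_⟩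
    ext p q
    fin_cases p <;> fin_cases q <;> simp [Matrix.submatrix_apply, h0, h1, h2, h3]
    all_goals first
      | exact S1 _ hab | exact S1 _ hkb | exact S1 _ (Ne.symm hb3)
      | exact S2 _ (Ne.symm hab) | exact S2 _ hka | exact S2 _ (Ne.symm ha3)
      | exact U1 _ ha3 | exact U1 _ hb3 | exact U1 _ hk3
      | exact U2 _ (Ne.symm hka) | exact U2 _ (Ne.symm hkb) | exact U2 _ (Ne.symm hk3)
      | exact S3.symm | exact U3.symm

end Summit.ValiantsHypothesis.ValiantsHypothesis.Theorems.SymPencilPerFourPeeledTwoPencilClassify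

end
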